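import Literature.AnabelianGeometry.EtaleTheta.Discharge.Sec3HQOfRationalSupport
import Literature.AnabelianGeometry.EtaleTheta.Discharge.Sec3ConstantLineOfRlfQR
import HarnessLib

/-!
# [EtTh] Cor. 3.8 proof, row C38-L05 at the CONSTRUCTED Def. 3.6 (i) data of monoid type `ℤ` and `ℚ`
# (`ofRlfZ`, `ofRlfQ`): the criterion modulo `B₀`/`Φ₀`-level print statements only — `hNZ` and `hQ` both derived

Proof-only knit (theorems only, no `def`) in the series `Discharge/Sec3*.lean`, cell abc-iut, sub-DAG
`plan/L2/SUBDAG-EtTh-Cor38.md` row C38-L05; seat abc-iut-w5-d130 (gen 5), continuation of p433386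
(`Sec3HQOfRationalSupport.lean`).  S. Mochizuki, *The étale theta function …*, Publ. RIMS **45** (2009) [EtTh],
proof of Cor. 3.8, PDF p.81 l.20–27 (the base-field-theoretic pre-step criterion); Def. 3.6 (i)–(ii) pp.76–77;
Prop. 3.4 (ii) p.74; Remark 3.3.1 p.73 [cite: MochizukiEtTh2009, Cor 3.8 p.81].

The residual binders of row C38-L05 at the tree vocabulary are `{hP34Λ (typed field), hNZ (G-w5d124-2), hQ
(G-w4d084-3)}` (abc-iut-w4-d084's `bsFldPreStepLimitCriterion_of_coord'`, p430420).  At the CONSTRUCTED realified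
data abc-iut-w4-d008 derived `hP34Λ` and `hNZ` from `B₀`-level statements (`ofRlfZ_mem_FΛ_of_divΛ_eq_of` from
`dm.Prop34`; `exists_cnstFn_effective_ofRlfZ` / `…_ofRlfQ` from `dm.Prop34` + `hcyc`, p428972 / p429470), leaving
`hSup`; abc-iut-w4-d084 then replaced `hSup` by `hQ` (p429156/p430420); p433386 derives `hQ` from (hZQ) on `Φ₀(Y)` and
(hsat) on `Φ(W)`.  THIS FILE assembles the three: for EVERY tempered Frobenioid `C₀` over `ofRlfZ dm hpf` (resp.
`ofRlfQ dm hpf`) which is a Frobenioid (`hF`), row C38-L05 holds for THE [FrdI] perfection GIVEN ONLY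
* `dm.Prop34` — [EtTh] Prop. 3.4 (typed, `B₀`-level),
* `hcyc` — "the divisor of a constant is an integral power of one effective divisor `d_Y`" (`div₀(F₀(Y)) ⊆ d_Y^ℤ`;
  Prop. 3.4 (ii) third isomorphism `F₀(Y) ≅ L^×` with `div(ϖ_L)`; census clause (2), G-w5d124-2),
* `hZQ` — every prime of `Φ₀(Y)` is a `ℤ`- or a `ℚ`-prime (Remark 3.3.1: `Φ₀(Y)_𝔭 ≅ ℤ_{≥0}`),
* `hsat` — `Φ(W)` has rational support in `Φ₀^ℝ(Y_W)` (Def. 3.6 (i)/(ii) at `Λ ∈ {ℤ, ℚ}`: `Φ ⊆ Φ₀^Λ|_D`; census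
  clause (4), G-w4d084-3),
i.e. modulo statements about the Def. 3.3 (iii) data and the containment `Φ ⊆ Φ₀^ℚ` ALONE — no binder on the
interface artefacts `Φ^{bs-fld}`, `F`, `B` remains (`bsFldPreStepLimitCriterion_ofRlfZ_of_ratSupport`,
`bsFldPreStepLimitCriterion_ofRlfQ_of_ratSupport`; `hQ` alone: `hQ_ofRlfZ_of_ratSupport`, `hQ_ofRlfQ_of_ratSupport`).
HONEST FRAMING: refereed pre-IUT material; the four hypotheses are print's standing situation for the geometric
data and are NOT derivable from the typed interfaces (kernel certificates: `ToyHNZ` p427694 for `hcyc`/`hNZ`,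
`Sec3Cor38CriterionToy` p425444 for the row itself); nothing here bears on [IUTchIII] Cor. 3.12; typed ≠ proved.
-/

noncomputable section

namespace Literature.AnabelianGeometry.EtaleTheta

open CategoryTheory Opposite Function Literature.AlgebraicGeometry.Frobenioids

universe u₀ v₀ u v w

namespace TemperedFrobenioid

variable {D₀ : Type u} [Category.{v} D₀] {dm : DivisorMonoids.{u, v, w} D₀}
  {hpf : ∀ Y : D₀ᵒᵖ, IsPerfFactorial (dm.Φ₀.obj Y)} {V : FrdIMonoidStub.{w}} {V₀ : FrdICatStub.{u, v, w} D₀}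
  {D : Type u₀} [Category.{v₀} D] {VD : FrdICatStub.{u₀, v₀, w} D}

section Z

variable (C₀ : TemperedFrobenioid (RealifiedDivisorMonoids.ofRlfZ dm hpf) D VD)

/-- **`hQ` at the constructed data of monoid type `ℤ`**: for a tempered Frobenioid over `ofRlfZ dm hpf`, if every
prime of `Φ₀(Y_W)` is a `ℤ`- or a `ℚ`-prime and `Φ(W)` has rational support in `Φ₀(Y_W)^rlf` (every divisor has a
power in the image of `Φ₀(Y_W) → Φ₀(Y_W)^pf → Φ₀(Y_W)^rlf`), then every `Φ(W)^pf_𝔮` is `ℚ`-monoprime.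
[cite: MochizukiEtTh2009, Def 3.6 p.76] -/
theorem hQ_ofRlfZ_of_ratSupport (W : D)
    (hZQ : ∀ 𝔭 : Primes (dm.Φ₀.obj (C₀.baseOp (op W))), IsZMonoprime ↥𝔭.submonoid ∨ IsQMonoprime ↥𝔭.submonoid)
    (hsat : ∀ x ∈ C₀.Φ.carrier (op W), ∃ (N : ℕ+) (d : dm.Φ₀.obj (C₀.baseOp (op W))),
      x ^ (N : ℕ) = (hpf (C₀.baseOp (op W))).toRealification (Perfection.of _ d))
    (𝔮 : Primes (Perfection (C₀.divisorMonoid.obj (op W)))) :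
    IsQMonoprime (PfAt (C₀.divisorMonoid.obj (op W)) 𝔮) :=
  isQMonoprime_pfAt_divisorMonoid_of_ratSupport W hZQ hsat 𝔮

/-- **Row C38-L05 over `ofRlfZ dm hpf` modulo `B₀`/`Φ₀`-level print statements only**: the base-field-theoretic
pre-step criterion for THE perfection of the Frobenioid `hF`, from `dm.Prop34` (Prop. 3.4), `hcyc` (divisors of
constants are powers of one effective divisor), `hZQ` (primes of `Φ₀(Y)` of type `ℤ`/`ℚ`) and `hsat` (rational
support of `Φ`) — `hP34Λ`, `hNZ` (abc-iut-w4-d008) and `hQ` (p433386) being DERIVED.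
[cite: MochizukiEtTh2009, Cor 3.8 p.81] -/
theorem bsFldPreStepLimitCriterion_ofRlfZ_of_ratSupport (hF : PreFrobenioid.IsFrobenioid C₀.toElem)
    (h34 : dm.Prop34 V V₀)
    (hcyc : ∀ Y : D₀ᵒᵖ, ∃ d : dm.Φ₀.obj Y, ∀ b ∈ dm.F₀ Y, ∃ n : ℤ,
      dm.div₀ Y b = Algebra.GrothendieckGroup.of d ^ n)
    (hZQ : ∀ (W : D) (𝔭 : Primes (dm.Φ₀.obj (C₀.baseOp (op W)))),
      IsZMonoprime ↥𝔭.submonoid ∨ IsQMonoprime ↥𝔭.submonoid)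
    (hsat : ∀ (W : D), ∀ x ∈ C₀.Φ.carrier (op W), ∃ (N : ℕ+) (d : dm.Φ₀.obj (C₀.baseOp (op W))),
      x ^ (N : ℕ) = (hpf (C₀.baseOp (op W))).toRealification (Perfection.of _ d)) :
    C₀.BsFldPreStepLimitCriterion (PreFrobenioidData.perfection hF) :=
  bsFldPreStepLimitCriterion_of_ratSupport C₀ hF (RealifiedDivisorMonoids.ofRlfZ_mem_FΛ_of_divΛ_eq_of dm hpf h34)
    (exists_cnstFn_effective_ofRlfZ C₀ h34 hcyc) hZQ hsat

end Z

section Q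

variable (C₀ : TemperedFrobenioid (RealifiedDivisorMonoids.ofRlfQ dm hpf) D VD)

/-- **`hQ` at the constructed data of monoid type `ℚ`** (`B₀^ℚ = B₀^pf`, `F₀^ℚ = F₀^pf`, same `Φ₀^ℝ = Φ₀^rlf`).
[cite: MochizukiEtTh2009, Def 3.6 p.76] -/
theorem hQ_ofRlfQ_of_ratSupport (W : D)
    (hZQ : ∀ 𝔭 : Primes (dm.Φ₀.obj (C₀.baseOp (op W))), IsZMonoprime ↥𝔭.submonoid ∨ IsQMonoprime ↥𝔭.submonoid)
    (hsat : ∀ x ∈ C₀.Φ.carrier (op W), ∃ (N : ℕ+) (d : dm.Φ₀.obj (C₀.baseOp (op W))),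
      x ^ (N : ℕ) = (hpf (C₀.baseOp (op W))).toRealification (Perfection.of _ d))
    (𝔮 : Primes (Perfection (C₀.divisorMonoid.obj (op W)))) :
    IsQMonoprime (PfAt (C₀.divisorMonoid.obj (op W)) 𝔮) :=
  isQMonoprime_pfAt_divisorMonoid_of_ratSupport W hZQ hsat 𝔮

/-- **Row C38-L05 over `ofRlfQ dm hpf` modulo `B₀`/`Φ₀`-level print statements only** (`hP34Λ` at `Λ = ℚ` from
`dm.Prop34` by abc-iut-w4-d084's `ofRlfQ_mem_FΛ_of_divΛ_eq_of'`, `hNZ` by abc-iut-w4-d008's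
`exists_cnstFn_effective_ofRlfQ`, `hQ` by p433386). [cite: MochizukiEtTh2009, Cor 3.8 p.81] -/
theorem bsFldPreStepLimitCriterion_ofRlfQ_of_ratSupport (hF : PreFrobenioid.IsFrobenioid C₀.toElem)
    (h34 : dm.Prop34 V V₀)
    (hcyc : ∀ Y : D₀ᵒᵖ, ∃ d : dm.Φ₀.obj Y, ∀ b ∈ dm.F₀ Y, ∃ n : ℤ,
      dm.div₀ Y b = Algebra.GrothendieckGroup.of d ^ n)
    (hZQ : ∀ (W : D) (𝔭 : Primes (dm.Φ₀.obj (C₀.baseOp (op W)))),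
      IsZMonoprime ↥𝔭.submonoid ∨ IsQMonoprime ↥𝔭.submonoid)
    (hsat : ∀ (W : D), ∀ x ∈ C₀.Φ.carrier (op W), ∃ (N : ℕ+) (d : dm.Φ₀.obj (C₀.baseOp (op W))),
      x ^ (N : ℕ) = (hpf (C₀.baseOp (op W))).toRealification (Perfection.of _ d)) :
    C₀.BsFldPreStepLimitCriterion (PreFrobenioidData.perfection hF) :=
  bsFldPreStepLimitCriterion_of_ratSupport C₀ hF
    (RealifiedDivisorMonoids.Prop34Cnst.ofRlfQ_mem_FΛ_of_divΛ_eq_of' h34)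
    (exists_cnstFn_effective_ofRlfQ C₀ h34 hcyc) hZQ hsat

end Q

end TemperedFrobenioid

end Literature.AnabelianGeometry.EtaleTheta

end
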